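import Literature.MathematicalPhysics.QuantumFieldTheory.Balaban1983to89.B9Thm37Glue

/-!
# B9Thm37GlueT — entry 3 of (3.42) for G′ = G′(U) (G′∇*_U) with (3.88) DERIVED: the transposes of the concrete
local operators of the lattice model (sibling leaf of `B9Thm37Glue`, which reached the gate's 200 000-byte file cap
at its v7; cell record D-pv21g5.6)

[B9] T. Bałaban, *Propagators for lattice gauge theories in a background field*, Commun. Math. Phys. **99** (1985)
389–434 [cite: Balaban1985BackgroundPropagators]; [4] = T. Bałaban, *Propagators and renormalization transformations
for lattice gauge theories. II*, Commun. Math. Phys. **96** (1984) 223–250 [cite: Balaban1984PropagatorsII].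

No new quotation: the print inputs are those quoted verbatim in `B9Thm37Glue` v6 (p. 391: *"The adjoints are taken
with respect to natural L² scalar products for functions with values in N × N hermitian matrices."*; p. 394
(3.23)–(3.24): *"Let us introduce the operator Δ′_a = Δ′_a(U) = (Δ^η_U + Q′*aQ′)↾_{Ω₀}, where Q′*aQ′ is defined by
the same quadratic form as in (2.14)"*; p. 395) and v7 (p. 408 Σ_□h²_□ = 1; p. 409 (3.87)–(3.88) both display lines +
*"hence Δ′_aG′₀ = I − Σ_□K(h_□)G′_□h_□ = I − R′."*).

THE POINT.  `B9Thm37Glue` v6 derived the transposed (3.88) needed for the right entry G′∇*_U from the printed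
(3.88) given NAMED transposes Pᵗ_□, Cᵗ_□ of the abstract local operators (`hP`, `hC`) and the symmetry of Δ′_a
(`hΔ`); v7 made P_□, C_□ CONCRETE (P_□ = leibRemT h_□, C_□ = −D*∘leibRem h_□ + [M_{h_□}, Q], Q = Q′*aQ′ abstract) and
derived (3.88) itself (`h388_lattice`).  This leaf closes the loop for entry 3: with Q SYMMETRIC for the component
pairing (`hQt : IsTransposePair Qf Qf` — in print a consequence of the DEFINITION of Q′*aQ′ by the quadratic form
(3.24)), the transposes are KERNEL facts: Pᵗ_□ = leibRem h_□ (`B9Thm37Glue.isTransposePair_leibRemT`), Cᵗ_□ =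
−(leibRemT h_□)∘D + (QM_{h_□} − M_{h_□}Q) (`isTransposePair_cop388`, from the v6 calculus + `isTransposePair_neg`),
Δ′_a = D*D + Q symmetric (`isTransposePair_covLap` + `hQt`); the block majorant of the new concrete piece
(leibRemT h_□)∘D is the kernel lemma `leibRemT_covD_majorant` (transpose partner of v5's `covDT_leibRem_majorant`;
hypothesis `hdomLT` on the explicit coefficients c(b)(∂h_□)(b)c(b)R(b)_{ij}), that of leibRem h_□ is v3's
`leibRem_majorant` (`hdh`), that of QM_{h_□} − M_{h_□}Q is v7's commutator HYPOTHESIS `hQ` (negated,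
`hasMajorantHom_neg`); column sums add (`colSum_add_le`).  `thm37_entry3_of_342_lattice_of_387` = v6's
`thm37_entry3_of_342_lattice_of_388` with `h388`, `hP`, `hC`, `hΔ` DISCHARGED.

* `isTransposePair_neg`, `colSum_add_le` (bookkeeping); `isTransposePair_cop388` (transpose of the concrete C_□);
* `leibRemT_covD_majorant` — block majorant of (leibRemT h)∘covD from the located coefficient domination `hdomLT`;
* `thm37_entry3_of_342_lattice_of_387` — **Theorem 3.7 ⇒ entry 3 of (3.42) for G′ with (3.88) DERIVED**.

NOT ASSERTED (hypotheses of the corollary): Corollary 3.6 entries 1, 3 for the G′_□ (`h342_1`, `h342_3`); the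
symmetry `hG` of every G′_□ and `hQt` of Q = Q′*aQ′ for the component pairing (print: quadratic-form definitions
(3.23)–(3.24), restricted inverses — not re-derived: no component model of Q′_j(U) / G′_□ in the lineage); the local
inverse `hloc`, Σ_□h²_□ = 1 `hsq`, G′Δ′_a = I `hinv` (Δ′_a = D*D + Q); the commutator majorant `hQ` with kernel K_Q
(COLUMN sums ≦ κ_Q1_{S′_□} against (L^{j″}η)²; print: second display line of (3.88), size not re-derived); the kernel
bounds `hdh` (K_P, column sums κ₁ against L^{j″}η), `hdomLT` (K_L, κ₂ against (L^{j″}η)²), `hdomT` (K_{C′}, κ₄) of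
∂h_□ — sizes implicit in (1.118)/(2.36), NOT displayed in print (cell GAPS G-pv21g4-1 (i)); the scale comparability
`hcomp` (C_ℓ) and the exponent loss (1 − 2α)δ₀ of the v4 right-entry walk (cell DIVERGENCE D-pv21g5.2); partition
data, Lemma 2.1 of [4], geometry (symmetric d, L^{j″}η > 0), located smallness N′B₀e^{δ₀ρ}(κ₁ + C_ℓ(κ₂ + κ_Q))c₁(α)
< 1.  STATE OF THE LINE: entries 2, 3, 4 of (3.42) for G′ from Corollary 3.6 for the G′_□ with (3.88) DERIVED in the
lattice model (Q′*aQ′ abstract: symmetric, with a located commutator majorant); entry 1 = `B9Thm37Glue` v2 (abstract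
K(h_□)).  Value: kernel-checked bookkeeping, NOT summit progress.
-/

namespace Literature.MathematicalPhysics.QuantumFieldTheory.Balaban1983to89.B9Thm37GlueT

open Literature.MathematicalPhysics.QuantumFieldTheory.Balaban1983to89
open Finset B6RandomWalk B6RandomWalkHom B9Thm37Sum B9Thm34Ext B9Thm37Glue

variable {g : B9.Geometry} [Fintype g.Site] [DecidableEq g.Site] {R : ℝ} {H : Prop} {X Y St Cp Bd : Type}

omit [DecidableEq g.Site] in
/-- Transposition commutes with negation. [folklore] -/
theorem isTransposePair_neg [Fintype X] [Fintype Y] {A : (X → ℝ) →ₗ[ℝ] (Y → ℝ)} {B : (Y → ℝ) →ₗ[ℝ] (X → ℝ)}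
    (h : IsTransposePair A B) : IsTransposePair (-A) (-B) := by
  intro u v
  simp only [LinearMap.neg_apply, Pi.neg_apply, neg_mul, mul_neg, Finset.sum_neg_distrib]
  rw [h u v]

/-- Column sums of a sum of two kernels against a weight, each bounded on S′ and vanishing off S′. [folklore] -/
theorem colSum_add_le {K₁ K₂ : g.Site → g.Site → ℝ} {w s₁ s₂ : ℝ} {S' : Finset g.Site} (b : g.Site)
    (h₁ : (∑ y, K₁ y b) * w ≤ if b ∈ S' then s₁ else 0) (h₂ : (∑ y, K₂ y b) * w ≤ if b ∈ S' then s₂ else 0) :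
    (∑ y, (K₁ y b + K₂ y b)) * w ≤ if b ∈ S' then s₁ + s₂ else 0 := by
  rw [Finset.sum_add_distrib, add_mul]
  refine (add_le_add h₁ h₂).trans (le_of_eq ?_)
  split_ifs <;> ring

/-- **The transposes of the concrete local operators of (3.88)** (lattice model of v7): for Q SYMMETRIC for the
component pairing (`hQt`; print: Q′*aQ′ is defined by the quadratic form (3.24), p. 394), the transpose of
C_□ = −D*∘leibRem h_□ + [M_{h_□}, Q] is Cᵗ_□ = −(leibRemT h_□)∘D + (QM_{h_□} − M_{h_□}Q) (transpose calculus of v6 +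
`isTransposePair_leibRemT`, `isTransposePair_covD`); the transpose of P_□ = leibRemT h_□ is leibRem h_□
(`isTransposePair_leibRemT` itself).  These are the data `hP`, `hC` of v6's `thm37_entry3_of_342_lattice_of_388`.
[folklore] -/
theorem isTransposePair_cop388 [Fintype St] [Fintype Bd] [Fintype Cp] [DecidableEq St] (src tgt : Bd → St)
    (c : Bd → ℝ) (Rm : Bd → Cp → Cp → ℝ) {Qf : Module.End ℝ (St × Cp → ℝ)} (hQt : IsTransposePair Qf Qf)
    (h : St → ℝ) :
    IsTransposePair
      (-(covDT src tgt c Rm ∘ₗ leibRem src tgt c h) + (mulOp (h ∘ Prod.fst) * Qf - Qf * mulOp (h ∘ Prod.fst)))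
      (-(leibRemT src tgt c h ∘ₗ covD src tgt c Rm) + (Qf * mulOp (h ∘ Prod.fst) - mulOp (h ∘ Prod.fst) * Qf)) :=
  (isTransposePair_neg ((isTransposePair_leibRemT src tgt c h).symm.comp (isTransposePair_covD src tgt c Rm).symm)).add
    (((isTransposePair_mulOp _).mul hQt).sub (hQt.mul (isTransposePair_mulOp _)))

/-- **Block majorant of (leibRemT h_□)∘D** — the transpose partner of `covDT_leibRem_majorant` (v5): in components
((leibRemT h)∘D λ)(x, i) = Σ_{b: b₋ = x} c(b)(∂h)(b)·c(b)(Σ_j R(b)_{ij}λ(b₊, j) − λ(x, i)); if the explicit coefficient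
sums are dominated blockwise by K(y, y′) (`hdomLT`: the R-transported part over the bond components starting at the
site component and landing in Δ(y′), plus the diagonal part when the site component itself lies in Δ(y′)), then K is
a block majorant.  Kernel (every c, Rm, h); the SIZE O((ML^jη)^{−1})·η^{−1} of the coefficients for the partition of
unity of [4] Sect. A is carried by K and not displayed in print. [cite: Balaban1985BackgroundPropagators, (3.88) p.409 + (3.3) pp.390–391; Balaban1984PropagatorsII, (2.39)–(2.40) pp.229–230] -/
theorem leibRemT_covD_majorant [Fintype Bd] [Fintype Cp] [DecidableEq St] (blk : St × Cp → g.Site)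
    (src tgt : Bd → St) (c : Bd → ℝ) (Rm : Bd → Cp → Cp → ℝ) (h : St → ℝ) (K : g.Site → g.Site → ℝ)
    (hdomLT : ∀ (p : St × Cp) (y' : g.Site),
      (∑ b ∈ Finset.univ.filter (fun b => src b = p.1),
          ∑ j ∈ Finset.univ.filter (fun j => blk (tgt b, j) = y'),
            |c b * (h (tgt b) - h (src b)) * c b * Rm b p.2 j|) +
        (if blk p = y' then |∑ b ∈ Finset.univ.filter (fun b => src b = p.1), c b * (h (tgt b) - h (src b)) * c b|
          else 0) ≤ K (blk p) y') :
    HasMajorantHom (g := toB6 g R H) blk blk (leibRemT src tgt c h ∘ₗ covD src tgt c Rm) K := by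
  intro y' μ B hμ p
  have hB : 0 ≤ B := hμ.nonneg
  have habs : ∀ x y : ℝ, |x - y| ≤ |x| + |y| := fun x y => by
    rw [sub_eq_add_neg, ← abs_neg y]
    exact abs_add_le _ _
  rw [LinearMap.comp_apply, leibRemT_apply]
  simp only [covD_apply]
  have hsplit : ∑ b, (if src b = p.1 then c b * (h (tgt b) - h (src b)) else 0) *
        (c b * (∑ j, Rm b p.2 j * μ (tgt b, j) - μ (src b, p.2))) =
      ∑ b, (if src b = p.1 then c b * (h (tgt b) - h (src b)) else 0) * (c b * ∑ j, Rm b p.2 j * μ (tgt b, j)) -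
        ∑ b, (if src b = p.1 then c b * (h (tgt b) - h (src b)) else 0) * (c b * μ (src b, p.2)) := by
    rw [← Finset.sum_sub_distrib]
    exact Finset.sum_congr rfl fun b _ => by ring
  -- the R-transported part, bond components starting at x
  have hA : |∑ b, (if src b = p.1 then c b * (h (tgt b) - h (src b)) else 0) *
        (c b * ∑ j, Rm b p.2 j * μ (tgt b, j))| ≤
      (∑ b ∈ Finset.univ.filter (fun b => src b = p.1),
          ∑ j ∈ Finset.univ.filter (fun j => blk (tgt b, j) = y'),
            |c b * (h (tgt b) - h (src b)) * c b * Rm b p.2 j|) * B := by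
    calc |∑ b, (if src b = p.1 then c b * (h (tgt b) - h (src b)) else 0) *
            (c b * ∑ j, Rm b p.2 j * μ (tgt b, j))|
        ≤ ∑ b, |(if src b = p.1 then c b * (h (tgt b) - h (src b)) else 0) *
            (c b * ∑ j, Rm b p.2 j * μ (tgt b, j))| := Finset.abs_sum_le_sum_abs _ _
      _ ≤ ∑ b, (if src b = p.1 then
            ∑ j, (if blk (tgt b, j) = y' then |c b * (h (tgt b) - h (src b)) * c b * Rm b p.2 j| * B else 0)
            else 0) := by
          refine Finset.sum_le_sum fun b _ => ?_
          by_cases hs : src b = p.1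
          · rw [if_pos hs, if_pos hs, Finset.mul_sum, Finset.mul_sum]
            refine (Finset.abs_sum_le_sum_abs _ _).trans (Finset.sum_le_sum fun j _ => ?_)
            by_cases hk : blk (tgt b, j) = y'
            · rw [if_pos hk, show c b * (h (tgt b) - h (src b)) * (c b * (Rm b p.2 j * μ (tgt b, j))) =
                  (c b * (h (tgt b) - h (src b)) * c b * Rm b p.2 j) * μ (tgt b, j) by ring, abs_mul]
              exact mul_le_mul_of_nonneg_left (hμ.bound _ hk) (abs_nonneg _)
            · rw [if_neg hk, hμ.off _ hk]
              simp
          · rw [if_neg hs, if_neg hs, zero_mul, abs_zero]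
      _ = (∑ b ∈ Finset.univ.filter (fun b => src b = p.1),
            ∑ j ∈ Finset.univ.filter (fun j => blk (tgt b, j) = y'),
              |c b * (h (tgt b) - h (src b)) * c b * Rm b p.2 j|) * B := by
          rw [Finset.sum_filter, Finset.sum_mul]
          refine Finset.sum_congr rfl fun b _ => ?_
          split_ifs
          · rw [Finset.sum_filter, Finset.sum_mul]
            exact Finset.sum_congr rfl fun k _ => by split_ifs <;> simp
          · rw [zero_mul]
  -- the diagonal part
  have hBt : |∑ b, (if src b = p.1 then c b * (h (tgt b) - h (src b)) else 0) * (c b * μ (src b, p.2))| ≤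
      (if blk p = y' then |∑ b ∈ Finset.univ.filter (fun b => src b = p.1), c b * (h (tgt b) - h (src b)) * c b|
        else 0) * B := by
    have hsum : ∑ b, (if src b = p.1 then c b * (h (tgt b) - h (src b)) else 0) * (c b * μ (src b, p.2)) =
        (∑ b ∈ Finset.univ.filter (fun b => src b = p.1), c b * (h (tgt b) - h (src b)) * c b) * μ p := by
      rw [Finset.sum_filter, Finset.sum_mul]
      refine Finset.sum_congr rfl fun b _ => ?_
      by_cases hs : src b = p.1
      · rw [if_pos hs, if_pos hs, hs, Prod.mk.eta]
        ring
      · rw [if_neg hs, if_neg hs, zero_mul, zero_mul]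
    rw [hsum, abs_mul]
    by_cases hp : blk p = y'
    · rw [if_pos hp]
      exact mul_le_mul_of_nonneg_left (hμ.bound _ hp) (abs_nonneg _)
    · rw [if_neg hp, hμ.off _ hp, abs_zero, mul_zero, zero_mul]
  rw [hsplit]
  calc _ ≤ _ := habs _ _
    _ ≤ _ := add_le_add hA hBt
    _ = ((∑ b ∈ Finset.univ.filter (fun b => src b = p.1),
            ∑ j ∈ Finset.univ.filter (fun j => blk (tgt b, j) = y'),
              |c b * (h (tgt b) - h (src b)) * c b * Rm b p.2 j|) +
          (if blk p = y' then
            |∑ b ∈ Finset.univ.filter (fun b => src b = p.1), c b * (h (tgt b) - h (src b)) * c b| else 0)) * B := by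
        ring
    _ ≤ K (blk p) y' * B := mul_le_mul_of_nonneg_right (hdomLT p y') hB

/-- **Theorem 3.7 ⇒ entry 3 of (3.42) for G′ = G′(U) (G′∇*_U) with (3.88) DERIVED** — v6's
`thm37_entry3_of_342_lattice_of_388` with its hypotheses `h388` (printed-shape (3.88)), `hP`, `hC` (named transposes
of the local operators) and `hΔ` (symmetry of Δ′_a) DISCHARGED in the lattice model of v7: Δ′_a := D*D + Q with Q
SYMMETRIC (`hQt`; print: the quadratic form (3.24)), P_□ = leibRemT h_□ (Pᵗ_□ = leibRem h_□, majorant from the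
entrywise domination `hdh` via `leibRem_majorant`), C_□ = −D*∘leibRem h_□ + [M_{h_□}, Q] (Cᵗ_□ = −(leibRemT h_□)∘D +
(QM_{h_□} − M_{h_□}Q), majorant from `leibRemT_covD_majorant` (`hdomLT`) and the commutator HYPOTHESIS `hQ`), (3.88)
from the local inverse `hloc` + Σh²_□ = 1 `hsq` (`h388_lattice`).  Remaining print inputs: Corollary 3.6 entries 1, 3
for the G′_□, the symmetry `hG` of the G′_□, G′Δ′_a = I, the kernel bounds (`hdh` κ₁, `hdomLT` κ₂, K_Q κ_Q — COLUMN
sums, located on S′_□ —, `hdomT` κ₄), the scale comparability `hcomp` (C_ℓ), Lemma 2.1 of [4], counts, located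
smallness N′B₀e^{δ₀ρ}(κ₁ + C_ℓ(κ₂ + κ_Q))c₁(α) < 1, 0 ≦ αδ₀, 0 ≦ (1 − 2α)δ₀.
[cite: Balaban1985BackgroundPropagators, Thm 3.7 (3.87)–(3.90) pp.408–410 + (3.42) p.397 + (3.23)–(3.24) p.394 + p.391; Balaban1984PropagatorsII, Prop 2.2 (2.67) p.234] -/
theorem thm37_entry3_of_342_lattice_of_387 [Fintype St] [DecidableEq St] [Fintype Cp] [DecidableEq Cp]
    [Fintype Bd] [DecidableEq Bd] (blk : St × Cp → g.Site) (blkY : Bd × Cp → g.Site) (src tgt : Bd → St)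
    (c : Bd → ℝ) (Rm : Bd → Cp → Cp → ℝ) (Qf : Module.End ℝ (St × Cp → ℝ)) (d : ℕ)
    (δ₀ α ρ B₀ κ₁ κ₂ κQ κ₄ Cℓ N N' : ℝ) {ι : Type} [Fintype ι]
    (S S' : ι → Finset g.Site) (hs : ι → St → ℝ) (KP KL KQ KC' : ι → g.Site → g.Site → ℝ)
    {G' : Module.End ℝ (St × Cp → ℝ)}
    (hB₀ : 0 ≤ B₀) (hδ₀ : 0 ≤ δ₀) (hκ₁ : 0 ≤ κ₁) (hκ₂ : 0 ≤ κ₂) (hκQ : 0 ≤ κQ) (hκ₄ : 0 ≤ κ₄) (hCℓ : 0 ≤ Cℓ)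
    (hN : 0 ≤ N) (hN' : 0 ≤ N') (hαδ : 0 ≤ α * δ₀) (hαδ2 : 0 ≤ (1 - 2 * α) * δ₀)
    (htri : Triangle254 (toB6 g R H)) (hrefl : ∀ y : g.Site, g.dist y y = 0)
    (hsym : ∀ y y' : g.Site, g.dist y y' = g.dist y' y) (hdnn : ∀ y y' : g.Site, 0 ≤ g.dist y y')
    (hlenpos : ∀ y : g.Site, 0 < g.len y)
    (h261 : Ineq261 d (toB6 g R H) δ₀ α) (h263 : Ineq263 d (toB6 g R H) δ₀ α)
    (hsmall : N' * (B₀ * Real.exp (δ₀ * ρ) * (κ₁ + Cℓ * (κ₂ + κQ))) * B6.c1 d δ₀ α < 1)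
    (hh : ∀ i x, |hs i x| ≤ 1) (hS : ∀ i (p : St × Cp), hs i p.1 ≠ 0 → blk p ∈ S i)
    (hcnt : ∀ a : g.Site, (∑ i, if a ∈ S i then (1 : ℝ) else 0) ≤ N)
    (hcnt' : ∀ b : g.Site, (∑ i, if b ∈ S' i then (1 : ℝ) else 0) ≤ N')
    (hcomp : ∀ i (a b : g.Site), a ∈ S i → b ∈ S' i → g.len a ≤ Cℓ * g.len b)
    (hKP : ∀ i a b, 0 ≤ KP i a b) (hlocP : ∀ i y'' b, KP i y'' b ≠ 0 → g.dist y'' b ≤ ρ)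
    (hcolP : ∀ i (b : g.Site), (∑ y'' : g.Site, KP i y'' b) * g.len b ≤ if b ∈ S' i then κ₁ else 0)
    (hKL : ∀ i a b, 0 ≤ KL i a b) (hlocL : ∀ i y'' b, KL i y'' b ≠ 0 → g.dist y'' b ≤ ρ)
    (hcolL : ∀ i (b : g.Site), (∑ y'' : g.Site, KL i y'' b) * g.len b ^ 2 ≤ if b ∈ S' i then κ₂ else 0)
    (hKQ : ∀ i a b, 0 ≤ KQ i a b) (hlocQ : ∀ i y'' b, KQ i y'' b ≠ 0 → g.dist y'' b ≤ ρ)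
    (hcolQ : ∀ i (b : g.Site), (∑ y'' : g.Site, KQ i y'' b) * g.len b ^ 2 ≤ if b ∈ S' i then κQ else 0)
    (hKC' : ∀ i a b, 0 ≤ KC' i a b) (hlocC' : ∀ i y'' b, KC' i y'' b ≠ 0 → g.dist y'' b ≤ ρ)
    (hcolC' : ∀ i (b : g.Site), (∑ y'' : g.Site, KC' i y'' b) * g.len b ≤ if b ∈ S' i then κ₄ else 0)
    (hdomT : ∀ i (p : St × Cp) (y' : g.Site),
      ∑ b ∈ Finset.univ.filter (fun b => src b = p.1 ∧ blkY (b, p.2) = y'), |c b * (hs i (tgt b) - hs i (src b))| ≤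
        KC' i (blk p) y')
    (hdh : ∀ i (v : Bd × Cp), |c v.1 * (hs i (tgt v.1) - hs i (src v.1))| ≤ KP i (blkY v) (blk (src v.1, v.2)))
    (hdomLT : ∀ i (p : St × Cp) (y' : g.Site),
      (∑ b ∈ Finset.univ.filter (fun b => src b = p.1),
          ∑ j ∈ Finset.univ.filter (fun j => blk (tgt b, j) = y'),
            |c b * (hs i (tgt b) - hs i (src b)) * c b * Rm b p.2 j|) +
        (if blk p = y' then
          |∑ b ∈ Finset.univ.filter (fun b => src b = p.1), c b * (hs i (tgt b) - hs i (src b)) * c b| else 0) ≤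
        KL i (blk p) y')
    (hsq : ∀ x : St, ∑ i, hs i x ^ 2 = 1)
    {Gsq : ι → Module.End ℝ (St × Cp → ℝ)}
    (h342_1 : ∀ i, HasMajorant (g := toB6 g R H) blk (Gsq i)
      (fun a b => B₀ * g.len a ^ 2 * Real.exp (-(δ₀ * g.dist a b))))
    (h342_3 : ∀ i, HasMajorantHom (g := toB6 g R H) blkY blk (Gsq i ∘ₗ covDT src tgt c Rm)
      (fun a b => B₀ * g.len a * Real.exp (-(δ₀ * g.dist a b))))
    (hQ : ∀ i, HasMajorant (g := toB6 g R H) blk (mulOp (hs i ∘ Prod.fst) * Qf - Qf * mulOp (hs i ∘ Prod.fst)) (KQ i))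
    (hQt : IsTransposePair Qf Qf) (hG : ∀ i, IsTransposePair (Gsq i) (Gsq i))
    (hloc : ∀ i, mulOp (hs i ∘ Prod.fst) * (covDT src tgt c Rm ∘ₗ covD src tgt c Rm + Qf) * Gsq i *
      mulOp (hs i ∘ Prod.fst) = mulOp (hs i ∘ Prod.fst) * mulOp (hs i ∘ Prod.fst))
    (hinv : G' * (covDT src tgt c Rm ∘ₗ covD src tgt c Rm + Qf) = 1) :
    HasMajorantHom (g := toB6 g R H) blkY blk (G' ∘ₗ covDT src tgt c Rm)
      (fun (a b : g.Site) => B₀ * (N + N' * Real.exp (δ₀ * ρ) * Cℓ * κ₄) * B6.c1 d δ₀ α *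
        (1 - N' * (B₀ * Real.exp (δ₀ * ρ) * (κ₁ + Cℓ * (κ₂ + κQ))) * B6.c1 d δ₀ α)⁻¹ * g.len a *
        Real.exp (-((1 - 2 * α) * δ₀ * g.dist a b))) := by
  have hPt : ∀ i, HasMajorantHom (g := toB6 g R H) blk blkY (leibRem src tgt c (hs i)) (KP i) :=
    fun i => leibRem_majorant blk blkY src tgt c (hs i) (KP i) (hKP i) (hdh i)
  have hQ' : ∀ i, HasMajorant (g := toB6 g R H) blk
      (Qf * mulOp (hs i ∘ Prod.fst) - mulOp (hs i ∘ Prod.fst) * Qf) (KQ i) := fun i => by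
    rw [← neg_sub]
    exact (hasMajorantHom_iff (g := toB6 g R H) blk _ _).mp
      (hasMajorantHom_neg blk blk ((hasMajorantHom_iff (g := toB6 g R H) blk _ _).mpr (hQ i)))
  have hCt : ∀ i, HasMajorant (g := toB6 g R H) blk
      (-(leibRemT src tgt c (hs i) ∘ₗ covD src tgt c Rm) + (Qf * mulOp (hs i ∘ Prod.fst) - mulOp (hs i ∘ Prod.fst) * Qf))
      (fun a b => KL i a b + KQ i a b) := fun i =>
    (hasMajorantHom_iff (g := toB6 g R H) blk _ _).mp
      (hasMajorantHom_add (g := toB6 g R H) blk blk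
        (hasMajorantHom_neg blk blk (leibRemT_covD_majorant blk src tgt c Rm (hs i) (KL i) (hdomLT i)))
        ((hasMajorantHom_iff (g := toB6 g R H) blk _ _).mpr (hQ' i)))
  have hKC : ∀ i a b, 0 ≤ KL i a b + KQ i a b := fun i a b => add_nonneg (hKL i a b) (hKQ i a b)
  have hlocC : ∀ i y'' b, KL i y'' b + KQ i y'' b ≠ 0 → g.dist y'' b ≤ ρ := fun i y'' b hne => by
    by_cases h1 : KL i y'' b = 0
    · rw [h1, zero_add] at hne
      exact hlocQ i y'' b hne
    · exact hlocL i y'' b h1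
  have hcolC : ∀ i (b : g.Site), (∑ y'' : g.Site, (KL i y'' b + KQ i y'' b)) * g.len b ^ 2 ≤
      if b ∈ S' i then κ₂ + κQ else 0 := fun i b => colSum_add_le b (hcolL i b) (hcolQ i b)
  exact thm37_entry3_of_342_lattice_of_388 (P := fun i => leibRemT src tgt c (hs i))
    (Cop := fun i => -(covDT src tgt c Rm ∘ₗ leibRem src tgt c (hs i)) +
      (mulOp (hs i ∘ Prod.fst) * Qf - Qf * mulOp (hs i ∘ Prod.fst)))
    (Pt := fun i => leibRem src tgt c (hs i))
    (Ct := fun i => -(leibRemT src tgt c (hs i) ∘ₗ covD src tgt c Rm) +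
      (Qf * mulOp (hs i ∘ Prod.fst) - mulOp (hs i ∘ Prod.fst) * Qf))
    blk blkY src tgt c Rm d δ₀ α ρ B₀ κ₁ (κ₂ + κQ) κ₄ Cℓ N N' S S' hs KP (fun i a b => KL i a b + KQ i a b) KC'
    hB₀ hδ₀ hκ₁ (add_nonneg hκ₂ hκQ) hκ₄ hCℓ hN hN' hαδ hαδ2 htri hrefl hsym hdnn hlenpos h261 h263 hsmall hh hS
    hcnt hcnt' hcomp hKP hlocP hcolP hKC hlocC hcolC hKC' hlocC' hcolC' hdomT h342_1 h342_3 hPt hCt hinv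
    ((isTransposePair_covLap src tgt c Rm).add hQt) hG (fun i => isTransposePair_leibRemT src tgt c (hs i))
    (fun i => isTransposePair_cop388 src tgt c Rm hQt (hs i)) (h388_lattice src tgt c Rm Qf hs Gsq hsq hloc)


/-! ## v2 ADDENDUM — entry 1 of (3.42) for G′ = G′(U) with (3.88) DERIVED in the lattice model (cell record
D-pv21g5.7)

p. 410, ll. 1–5 (verbatim, already quoted in `B9Thm37Glue` v1): *"This theorem follows simply from Corollary 3.6
holding for all G′_□, □∈𝒟, from the bound (3.89) and Lemma 2.1. The arguments are exactly the same as in proofs of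
Proposition 1.2 [3] and Proposition 2.2 [4], so we will not repeat them here. Theorem 3.7 implies that all the
inequalities (3.42)–(3.47) hold for G′, thus we have completed the proof of Theorem 3.1."*

`B9Thm37Glue.thm37_entry1_of_342` (v1) derives entry 1 of (3.42) for G′ from Corollary 3.6 entries 1, 2 for the
G′_□ with the local operators of K(h_□) = P_□∘D + C_□ ABSTRACT (block majorants `hP`, `hC` as hypotheses) and the
printed-shape (3.88) as the HYPOTHESIS `h388`.  Here these three are DISCHARGED in the lattice model of
`B9Thm37Glue` v7 exactly as v7 did for entries 2, 4 and this leaf's v1 for entry 3: X = sites × colours, Y = bonds ×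
colours, D = `covD`, P_□ = leibRemT h_□ (block majorant from the located coefficient domination `hdomT`,
`leibRemT_majorant`), C_□ = −D*∘leibRem h_□ + [M_{h_□}, Q] (block majorant from `hdomL`, `covDT_leibRem_majorant`,
plus the commutator HYPOTHESIS `hQ`; row sums add, `rowSum_add_le`), (3.88) := `h388_lattice` (local inverse `hloc`
+ Σ_□h²_□ = 1 `hsq`).

* `thm37_entry1_of_342_lattice_of_387` — **Theorem 3.7 ⇒ entry 1 of (3.42) for G′ with (3.88) DERIVED**:
  |(G′λ)(x)| ≦ NB₀c₁(α)(1 − N′B₀e^{δ₀ρ}(κ₁ + κ₂ + κ_Q)c₁(α))^{−1}(L^{j″}η)²e^{−(1−α)δ₀d(y,y′)}|λ| for x ∈ B(y), supp λ ⊂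
  B(y′).

STATE OF THE LINE after v2: ALL FOUR entries of (3.42) for G′ follow from Corollary 3.6 for the G′_□ with (3.88)
DERIVED in the lattice model — entry 1 here, entries 2, 4 `B9Thm37Glue.thm37_entry2/4_of_342_lattice_of_387` (v7),
entry 3 `thm37_entry3_of_342_lattice_of_387` (v1 of this leaf).  NOT ASSERTED (hypotheses): Corollary 3.6 entries
1, 2 for the G′_□ (`h342_1`, `h342_2`); the kernel bounds `hdomT` (K_P: nonnegative, range ρ, ROW sums ≦ κ₁1_{S′_□}
against L^{j″}η) and `hdomL` (K_L: row sums ≦ κ₂1_{S′_□} against (L^{j″}η)²) of the ∂h_□ coefficients — sizes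
implicit in (1.118)/(2.36), NOT displayed in print (cell GAPS G-pv21g4-1 (i)); the commutator majorant `hQ` (K_Q, row
sums κ_Q; Q = Q′*aQ′ abstract); `hloc`, `hsq`, G′Δ′_a = I `hinv`; partition data (|h_□| ≦ 1, supports, counts N,
N′); Lemma 2.1 of [4] ((2.61), (2.63)); geometry; located smallness N′B₀e^{δ₀ρ}(κ₁ + κ₂ + κ_Q)c₁(α) < 1 («M
sufficiently large»); (3.43)–(3.47) (Hölder-quotient norms) are NOT touched.  Value: kernel-checked bookkeeping,
NOT summit progress. -/

/-- **Theorem 3.7 ⇒ entry 1 of (3.42) for G′ = G′(U) with (3.88) DERIVED** — `B9Thm37Glue.thm37_entry1_of_342`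
(v1) with `hP`, `hC`, `h388` DISCHARGED in the lattice model (Δ′_a = D*D + Q, Q abstract with the commutator
majorant `hQ`; P_□ = leibRemT h_□ with kernel bound `hdomT` (κ₁), C_□ = −D*∘leibRem h_□ + [M_{h_□}, Q] with kernel
bounds `hdomL` (κ₂) and `hQ` (κ_Q); local inverse `hloc`, Σ_□h²_□ = 1 `hsq`, `h388_lattice`); every other input as
in v1 of `B9Thm37Glue` (Cor. 3.6 entries 1, 2 for the G′_□, |h_□| ≦ 1 and supports, Lemma 2.1 of [4], counts,
located smallness N′B₀e^{δ₀ρ}(κ₁ + κ₂ + κ_Q)c₁(α) < 1).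
[cite: Balaban1985BackgroundPropagators, Thm 3.7 (3.87)–(3.90) pp.408–410 + (3.42) p.397; Balaban1984PropagatorsII, Prop 2.2 (2.64)–(2.67) p.234] -/
theorem thm37_entry1_of_342_lattice_of_387 [Fintype St] [DecidableEq St] [Fintype Bd] [DecidableEq Bd] [Fintype Cp]
    [DecidableEq Cp]
    (src tgt : Bd → St) (c : Bd → ℝ) (Rm : Bd → Cp → Cp → ℝ) (Qf : Module.End ℝ (St × Cp → ℝ))
    (blk : St × Cp → g.Site) (blkY : Bd × Cp → g.Site) (d : ℕ) (δ₀ α ρ B₀ κ₁ κ₂ κQ N N' : ℝ) {ι : Type}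
    [Fintype ι] (S S' : ι → Finset g.Site) (hs : ι → St → ℝ) (KP KL KQ : ι → g.Site → g.Site → ℝ)
    {G' : Module.End ℝ (St × Cp → ℝ)}
    (hB₀ : 0 ≤ B₀) (hδ₀ : 0 ≤ δ₀) (hκ : 0 ≤ κ₁ + κ₂) (hκQ : 0 ≤ κQ) (hN : 0 ≤ N) (hN' : 0 ≤ N')
    (hαδ : 0 ≤ (1 - α) * δ₀)
    (htri : Triangle254 (toB6 g R H)) (hrefl : ∀ y : g.Site, g.dist y y = 0)
    (hdnn : ∀ y y' : g.Site, 0 ≤ g.dist y y') (hlen : ∀ y : g.Site, 0 ≤ g.len y)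
    (h261 : Ineq261 d (toB6 g R H) δ₀ α) (h263 : Ineq263 d (toB6 g R H) δ₀ α)
    (hsmall : N' * (B₀ * Real.exp (δ₀ * ρ) * (κ₁ + (κ₂ + κQ))) * B6.c1 d δ₀ α < 1)
    (hh : ∀ i x, |hs i x| ≤ 1) (hS : ∀ i (p : St × Cp), hs i p.1 ≠ 0 → blk p ∈ S i)
    (hcnt : ∀ a : g.Site, (∑ i, if a ∈ S i then (1 : ℝ) else 0) ≤ N)
    (hcnt' : ∀ a : g.Site, (∑ i, if a ∈ S' i then (1 : ℝ) else 0) ≤ N')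
    (hKP : ∀ i a b, 0 ≤ KP i a b) (hlocP : ∀ i a y'', KP i a y'' ≠ 0 → g.dist a y'' ≤ ρ)
    (hrowP : ∀ i (a : g.Site), ∑ y'' : g.Site, KP i a y'' * g.len y'' ≤ if a ∈ S' i then κ₁ else 0)
    (hKL : ∀ i a b, 0 ≤ KL i a b) (hlocL : ∀ i a y'', KL i a y'' ≠ 0 → g.dist a y'' ≤ ρ)
    (hrowL : ∀ i (a : g.Site), ∑ y'' : g.Site, KL i a y'' * g.len y'' ^ 2 ≤ if a ∈ S' i then κ₂ else 0)
    (hKQ : ∀ i a b, 0 ≤ KQ i a b) (hlocQ : ∀ i a y'', KQ i a y'' ≠ 0 → g.dist a y'' ≤ ρ)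
    (hrowQ : ∀ i (a : g.Site), ∑ y'' : g.Site, KQ i a y'' * g.len y'' ^ 2 ≤ if a ∈ S' i then κQ else 0)
    (hdomT : ∀ i (p : St × Cp) (y' : g.Site),
      ∑ b ∈ Finset.univ.filter (fun b => src b = p.1 ∧ blkY (b, p.2) = y'),
        |c b * (hs i (tgt b) - hs i (src b))| ≤ KP i (blk p) y')
    (hdomL : ∀ i (p : St × Cp) (y' : g.Site),
      (∑ b ∈ Finset.univ.filter (fun b => tgt b = p.1),
          ∑ k ∈ Finset.univ.filter (fun k => blk (src b, k) = y'),
            |c b * (c b * (hs i (tgt b) - hs i (src b))) * Rm b k p.2|) +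
        (if blk p = y' then
          |∑ b ∈ Finset.univ.filter (fun b => src b = p.1), c b * (c b * (hs i (tgt b) - hs i (src b)))| else 0) ≤
        KL i (blk p) y')
    (hsq : ∀ x : St, ∑ i, hs i x ^ 2 = 1)
    {Gsq : ι → Module.End ℝ (St × Cp → ℝ)}
    (h342_1 : ∀ i, HasMajorant (g := toB6 g R H) blk (Gsq i)
      (fun a b => B₀ * g.len a ^ 2 * Real.exp (-(δ₀ * g.dist a b))))
    (h342_2 : ∀ i, HasMajorantHom (g := toB6 g R H) blk blkY (covD src tgt c Rm ∘ₗ Gsq i)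
      (fun a b => B₀ * g.len a * Real.exp (-(δ₀ * g.dist a b))))
    (hQ : ∀ i, HasMajorant (g := toB6 g R H) blk (mulOp (hs i ∘ Prod.fst) * Qf - Qf * mulOp (hs i ∘ Prod.fst)) (KQ i))
    (hloc : ∀ i, mulOp (hs i ∘ Prod.fst) * (covDT src tgt c Rm ∘ₗ covD src tgt c Rm + Qf) * Gsq i *
      mulOp (hs i ∘ Prod.fst) = mulOp (hs i ∘ Prod.fst) * mulOp (hs i ∘ Prod.fst))
    (hinv : G' * (covDT src tgt c Rm ∘ₗ covD src tgt c Rm + Qf) = 1) :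
    HasMajorant (g := toB6 g R H) blk G'
      (fun (a b : g.Site) => N * B₀ * B6.c1 d δ₀ α *
        (1 - N' * (B₀ * Real.exp (δ₀ * ρ) * (κ₁ + (κ₂ + κQ))) * B6.c1 d δ₀ α)⁻¹ * g.len a ^ 2 *
        Real.exp (-((1 - α) * δ₀ * g.dist a b))) := by
  have hP : ∀ i, HasMajorantHom (g := toB6 g R H) blkY blk (leibRemT src tgt c (hs i)) (KP i) :=
    fun i => leibRemT_majorant blk blkY src tgt c (hs i) (KP i) (hdomT i)
  have hC : ∀ i, HasMajorant (g := toB6 g R H) blk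
      (-(covDT src tgt c Rm ∘ₗ leibRem src tgt c (hs i)) + (mulOp (hs i ∘ Prod.fst) * Qf - Qf * mulOp (hs i ∘ Prod.fst)))
      (fun a b => KL i a b + KQ i a b) := fun i =>
    (hasMajorantHom_iff (g := toB6 g R H) blk _ _).mp
      (hasMajorantHom_add (g := toB6 g R H) blk blk
        (hasMajorantHom_neg blk blk (covDT_leibRem_majorant blk src tgt c Rm (hs i) (KL i) (hdomL i)))
        ((hasMajorantHom_iff (g := toB6 g R H) blk _ _).mpr (hQ i)))
  have hKC : ∀ i a b, 0 ≤ KL i a b + KQ i a b := fun i a b => add_nonneg (hKL i a b) (hKQ i a b)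
  have hlocC : ∀ i a y'', KL i a y'' + KQ i a y'' ≠ 0 → g.dist a y'' ≤ ρ := fun i a y'' hne => by
    by_cases h1 : KL i a y'' = 0
    · rw [h1, zero_add] at hne
      exact hlocQ i a y'' hne
    · exact hlocL i a y'' h1
  have hrowC : ∀ i (a : g.Site), ∑ y'' : g.Site, (KL i a y'' + KQ i a y'') * g.len y'' ^ 2 ≤
      if a ∈ S' i then κ₂ + κQ else 0 := fun i a => rowSum_add_le a (hrowL i a) (hrowQ i a)
  have hκ'' : 0 ≤ κ₁ + (κ₂ + κQ) := by linarith
  exact thm37_entry1_of_342 (P := fun i => leibRemT src tgt c (hs i))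
    (Cop := fun i => -(covDT src tgt c Rm ∘ₗ leibRem src tgt c (hs i)) +
      (mulOp (hs i ∘ Prod.fst) * Qf - Qf * mulOp (hs i ∘ Prod.fst)))
    (D := covD src tgt c Rm) blk blkY d δ₀ α ρ B₀ κ₁ (κ₂ + κQ) N N' S S' (fun i => hs i ∘ Prod.fst) KP
    (fun i a b => KL i a b + KQ i a b) hB₀ hδ₀ hκ'' hN hN' hαδ htri hrefl hdnn hlen h261 h263 hsmall
    (fun i x => hh i x.1) (fun i x hx => hS i x hx) hcnt hcnt' hKP hlocP hrowP hKC hlocC hrowC h342_1 h342_2 hP hC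
    hinv (h388_lattice src tgt c Rm Qf hs Gsq hsq hloc)

end Literature.MathematicalPhysics.QuantumFieldTheory.Balaban1983to89.B9Thm37GlueT
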